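import Summits.BirchSwinnertonDyer.Rank1Residual.X5.TwoAdicInstancesINTP5302j
import Summits.BirchSwinnertonDyer.Rank1Residual.X5.TwoAdicTargetsSplitKappaCert
import Summits.BirchSwinnertonDyer.BirchSwinnertonDyer.Theorems.ByReductionTypeAtTwoMultUpperHalfKatoIntSplitCert
import HarnessLib

/-!
# X5 at `p = 2` (cell `bsd-2adic`, seat `bsd-2adic-mult`, GEN 8): class **5302j** (member `5302j1`) — the GS-FREE twins of the
# door theorems of `X5/TwoAdicInstancesINTP5302j.lean`: the named fact `greenberg_stevens c5302j1 2` (blocker B-ii, printed only for odd `p`)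
# is REPLACED by the per-class κ₁-valuation CERTIFICATE `hκ : O1.AnalyticKappaOneValuationAtTwo c5302j1`

HONEST FRAMING (cell `bsd-2adic`, run/shared/lean/pub/bsd-2adic/, HUMAN RULINGS D-0036 / D-0054):
PARTITION: X5@2 multiplicative, SPLIT, E[2]-irreducible (RESIDUAL-MAP B1·O1) — ONE book230 residue class, Cremona **5302j** × p = 2 —
types-the-object-of; closes none; nothing booked. The certificate `hκ` displays «[T¹]L₂(E) ≠ 0 ∧ ord₂ [T¹]L₂(E) = ord₂ 𝓛₂(E) + ord₂ [0]⁺_f − 2»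
for THE split `2`-adic `L`-function of the newform (a FINITE CHECK: `[T¹]L ≡ [T¹]L_n (mod 2ⁿ/den)` for the level-`2^{n+2}` Riemann sum);
CERTIFIED for this class: ord₂ c₁ = 4 at level n = 6 (den 2), ord₂ 𝓛₂ = 2, ord₂ [0]⁺ = 4 (c₁: e2@M12 j255662 (n=6) & e2@M8 j248630 (n=6); 𝓛₂: engine-S = PARI serreverse (kit j255544); [0]⁺: PARI ellanalyticrank = engine-2 x₀); table HOME/mult/CERT-KAPPA1.md. Every other binder is VERBATIM the one of the
imported instance file (PRINT / MEMO / CERTIFICATES as listed there); the rank-`0` `2`-converse form is NOT re-typed (it uses the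
Greenberg–Stevens identity itself, not a valuation). In analytic rank `0`, `greenberg_stevens c5302j1 2` IMPLIES `hκ`
(`O1.analyticKappaOneValuationAtTwo_of_greenbergStevens`), so these theorems are never weaker than the originals.
WHAT THIS IS NOT: not a proof of Greenberg–Stevens at `2`; not a discharge of T-KATO2-SPMULT or of any other binder.
References: [MazurTateTeitelbaum1986Invent] §I.13–15, §II; [GreenbergLNM1716] §4 pp. 112–113, Prop. 4.14; [Miller2011LMS] 1.1;
[CremonaAlgorithms1997] Table 1 (class 5302j).
-/

set_option autoImplicit false

open IsDedekindDomain WeierstrassCurve Literature.NumberTheory.EllipticCurves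
  Literature.NumberTheory.EllipticCurves.ModularForms
  Literature.NumberTheory.EllipticCurves.Rank1Residual
  Literature.NumberTheory.EllipticCurves.Rank1Residual.Typed
  Literature.NumberTheory.EllipticCurves.Greenberg1999
  Literature.NumberTheory.EllipticCurves.PolyCert
  Literature.NumberTheory.EllipticCurves.Rank1Residual.X11RankOneCertificates
  Summit.BirchSwinnertonDyer.Rank1Residual.X1.MuPart
  Summit.BirchSwinnertonDyer.Rank1Residual.X1.ParitySqueeze
  Summit.BirchSwinnertonDyer.Rank1Residual.X5.O1
  Summit.BirchSwinnertonDyer.BirchSwinnertonDyer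

open CongruenceSubgroup
open scoped MatrixGroups ModularForm

namespace Summit.BirchSwinnertonDyer.Rank1Residual.X5.Instances

/-- **UPPER HALF at `5302j1` by the Δ > 0 PARITY road — ON THE κ₁-VALUATION CERTIFICATE (no `greenberg_stevens`)** (`MissingUpperBoundAt`, item `MultUpperHalfAtTwo` per class): slack ONE from
the integral Kato datum with `c_∞ = 2`, then Cassels–Tate evenness of `ord₂ #Ш` and the even certificate `heven` (Cremona `#Ш_an = 16`)
squeeze to `ord₂ #Ш ≤ ord₂ #Ш_an`. [cite: GreenbergLNM1716, §4 pp. 112–113] [cite: SilvermanAEC2009, Thm. X.4.14] [cite: Miller2011LMS, Def. 1.1] -/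
theorem missingUpperBoundAt_two_5302j1_cert
    (hDD : DokchitserDokchitser2012_surjective_mod_two_four_eight)
    (h41 : thm41Analogue_charValue_rankZero_split_baseChange_anyPrime)
    (hκ : AnalyticKappaOneValuationAtTwo c5302j1)
    (hmod : nonempty_modularParametrizationData)
    (hGZK : rank_eq_analyticRank_of_analyticRank_le_one)
    (hCT : WeierstrassCurve.exists_casselsTate_pairing (K := ℚ))
    (hC : cesnavicius_not_two_dvd_maninConstant_of_two_dvd_level)
    (hK1sp : ∀ (κ : ZpExtension ℚ 2) (γ : Field.absoluteGaloisGroup ℚ), κ.IsCyclotomic → κ.IsTopGenerator γ →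
      IsCyclotomicVariable 2 γ →
      ∀ [NeZero (c5302j1.conductorNorm ℤ)] (f : CuspForm (Gamma0 (c5302j1.conductorNorm ℤ)) 2), IsNewformOf c5302j1 f →
      ∀ ϖ : ℚ, (ϖ : ℝ) * c5302j1.realPeriodRat = plusPeriod f →
      ∀ L : PowerSeries ℚ_[2], IsSplitMultPAdicLFunctionOf f 2 L → ∀ D : c5302j1.SelmerDualData κ γ,
        D.IsTorsion ∧ ∃ g ∈ D.charIdeal,
          iwasawaToPowerSeries 2 (PowerSeries.X * g) = PowerSeries.C ((2 * ϖ : ℚ) : ℚ_[2]) * L)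
    (heven : ∃ q : ℚ, shaAn c5302j1 = (q : ℂ) ∧ Even (padicValRat 2 q))
    (hr : c5302j1.analyticRank = 0) : MissingUpperBoundAt c5302j1 2 :=
  Theorems.missingUpperBoundAt_two_split_of_katoUpToOne_of_even_of_kappaCert c5302j1 h41 hκ hmod hGZK hCT hC hK1sp hr
    mult_two_5302j1 split_two_5302j1 (surj_two_5302j1 hDD) heven

end Summit.BirchSwinnertonDyer.Rank1Residual.X5.Instances
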